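import Summits.HubbardSuperconductivity.HubbardSuperconductivity.Theorems.ThermalWedgeTwSeededEnsembleEquivalenceRFreeColdEdgeReduction

/-!
# Crux `TwSeededEnsembleEquivalenceR` (stmt-HubbardSuperconductivity-15581), line `cold-floor-collapse`
# (slug `Sketch`) — calibration `cal_freeColdDiff`: the free sourced limit pressure is `μ`-differentiable

Support file (`--supports stmt-HubbardSuperconductivity-15581`; sorry-free; no definition). It proves the
registered calibration sub-goal `cal_freeColdDiff` of the line `Sketch`: at the solvable corner `U = 0` the
infinite-volume `d`-wave-sourced pressure, which is the explicit Brillouin-zone integral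
`I(β,μ,h) = (1/4π²)∫₀^{2π}∫₀^{2π} [2log2/β − ξ + (1/β)log((1+cosh βE)/2)] dθ₂ dθ₁`
(`ξ = −2(cos θ₁ + cos θ₂) − μ`, `E² = ξ² + 8h²(cos θ₁ − cos θ₂)²`; `cfl_freeSourcedPressure_limit`), is
differentiable in `μ` for every `β > 0`, `h`, `μ`, with derivative the zone-averaged BdG density
`N(β,μ,h) = (1/4π²)∫₀^{2π}∫₀^{2π} [1 − (ξ/E) tanh(βE/2)] dθ₂ dθ₁` (density `= ∂p/∂μ`): the free instance of
the physics statement DIFF.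

Proof. (1) The finite-volume convexity bracket `(μ₁−μ₂)·avg_L n(μ₂) ≤ p_L(μ₁) − p_L(μ₂) ≤ (μ₁−μ₂)·avg_L n(μ₁)`
(`cfl_pressure_increment_bracket`) passes to the limit `L → ∞` for ALL real `μ₂ ≤ μ₁`
(`cdf_q0_increment_bracket`, the interval-free version of `cfl_q0_increment_bracket`; limits
`cfl_freeSourcedPressure_limit`, `cfl_density_limit`). (2) `μ ↦ N(β,μ,h)` is continuous: the density is jointly
continuous in `(μ,θ₁,θ₂)` (kernel form `φ = ξ(β/2)∫₀¹sech²(tβE/2)dt`, `cfl_bdgPhi_eq_kernel`) and parametric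
interval integrals of jointly continuous functions are continuous (twice). (3) A function bracketed by a
continuous density is differentiable with that derivative (`cdf_hasDerivAt_of_bracket`:
`|I(μ') − I(μ) − (μ'−μ)N(μ)| ≤ |μ'−μ|·|N(μ') − N(μ)| = o(|μ'−μ|)`).
[folklore: BdG mean-field thermodynamics; convexity of the pressure in `μ`]
-/

set_option linter.dupNamespace false

namespace Summit.HubbardSuperconductivity.HubbardSuperconductivity.Theorems.TwSeededEnsembleEquivalenceR.ColdFloorLine

open Matrix Finset Literature.MathematicalPhysics.QuantumLattice Literature.Probability.LatticeModels
open scoped ComplexOrder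
open Real MeasureTheory intervalIntegral

/-! ### Generic: derivative from a two-sided increment bracket; continuity of zone averages -/

/-- **Derivative from a convexity bracket.** If `(μ₁−μ₂)N(μ₂) ≤ I(μ₁) − I(μ₂) ≤ (μ₁−μ₂)N(μ₁)` for all
`μ₂ ≤ μ₁` and `N` is continuous at `μ`, then `I` has derivative `N(μ)` at `μ`:
`|I(μ') − I(μ) − (μ'−μ)N(μ)| ≤ |μ'−μ|·|N(μ') − N(μ)|`. [folklore] -/
theorem cdf_hasDerivAt_of_bracket {I N : ℝ → ℝ} {μ : ℝ} (hN : ContinuousAt N μ)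
    (hbr : ∀ μ₁ μ₂ : ℝ, μ₂ ≤ μ₁ → (μ₁ - μ₂) * N μ₂ ≤ I μ₁ - I μ₂ ∧ I μ₁ - I μ₂ ≤ (μ₁ - μ₂) * N μ₁) :
    HasDerivAt I (N μ) μ := by
  rw [hasDerivAt_iff_isLittleO, Asymptotics.isLittleO_iff]
  intro c hc
  obtain ⟨δ, hδ, hδN⟩ := Metric.continuousAt_iff.1 hN c hc
  rw [Metric.eventually_nhds_iff]
  refine ⟨δ, hδ, fun μ' hμ' => ?_⟩
  have hNc : |N μ' - N μ| < c := by
    have := hδN hμ'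
    rwa [Real.dist_eq] at this
  rw [abs_sub_lt_iff] at hNc
  simp only [smul_eq_mul, Real.norm_eq_abs]
  rcases le_total μ μ' with hle | hle
  · obtain ⟨h1, h2⟩ := hbr μ' μ hle
    have h3 := mul_le_mul_of_nonneg_left hNc.1.le (sub_nonneg.2 hle)
    have h4 := mul_nonneg hc.le (sub_nonneg.2 hle)
    rw [abs_of_nonneg (sub_nonneg.2 hle), abs_le]
    constructor <;> nlinarith
  · obtain ⟨h1, h2⟩ := hbr μ μ' hle
    have h3 := mul_le_mul_of_nonneg_left hNc.2.le (sub_nonneg.2 hle)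
    have h4 := mul_nonneg hc.le (sub_nonneg.2 hle)
    rw [abs_of_nonpos (sub_nonpos.2 hle), abs_le]
    constructor <;> nlinarith

/-- **Zone averages of jointly continuous families are continuous**: if `(μ, θ₁, θ₂) ↦ n μ θ₁ θ₂` is
continuous then so is `μ ↦ (1/4π²)∫₀^{2π}∫₀^{2π} n μ θ₁ θ₂ dθ₂ dθ₁` (parametric interval integrals of
jointly continuous functions, twice). [folklore] -/
theorem cdf_continuous_zoneAverage {n : ℝ → ℝ → ℝ → ℝ} (hn : Continuous fun p : (ℝ × ℝ) × ℝ => n p.1.1 p.1.2 p.2) :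
    Continuous fun μ : ℝ => (∫ θ₁ in (0 : ℝ)..2 * π, ∫ θ₂ in (0 : ℝ)..2 * π, n μ θ₁ θ₂) / (4 * π ^ 2) := by
  have h2 : Continuous fun q : ℝ × ℝ => ∫ θ₂ in (0 : ℝ)..2 * π, n q.1 q.2 θ₂ :=
    intervalIntegral.continuous_parametric_intervalIntegral_of_continuous'
      (f := fun (q : ℝ × ℝ) (θ₂ : ℝ) => n q.1 q.2 θ₂) hn 0 (2 * π)
  have h1 : Continuous fun μ : ℝ => ∫ θ₁ in (0 : ℝ)..2 * π, ∫ θ₂ in (0 : ℝ)..2 * π, n μ θ₁ θ₂ :=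
    intervalIntegral.continuous_parametric_intervalIntegral_of_continuous'
      (f := fun (μ θ₁ : ℝ) => ∫ θ₂ in (0 : ℝ)..2 * π, n μ θ₁ θ₂) h2 0 (2 * π)
  exact h1.div_const _

/-! ### The BdG density is jointly continuous in `(μ, θ₁, θ₂)` -/

/-- The BdG density `n = 1 − φ_{D(θ)}(ξ(μ,θ))` is jointly continuous in `((μ, θ₁), θ₂)` (`β > 0`): kernel form
`φ = ξ (β/2) T(βE/2)` with the continuous `tanh` kernel `T`. [folklore] -/
theorem cdf_continuous_bdgDensity₃ (β s : ℝ) (hβ : 0 < β) :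
    Continuous fun p : (ℝ × ℝ) × ℝ => (1 - (if (-2 * (Real.cos p.1.2 + Real.cos p.2) - p.1.1) ^ 2 + (2 * Real.sqrt 2 * s * (Real.cos p.1.2 - Real.cos p.2)) ^ 2 = 0 then (0:ℝ) else (-2 * (Real.cos p.1.2 + Real.cos p.2) - p.1.1) / Real.sqrt ((-2 * (Real.cos p.1.2 + Real.cos p.2) - p.1.1) ^ 2 + (2 * Real.sqrt 2 * s * (Real.cos p.1.2 - Real.cos p.2)) ^ 2) * Real.tanh (β * Real.sqrt ((-2 * (Real.cos p.1.2 + Real.cos p.2) - p.1.1) ^ 2 + (2 * Real.sqrt 2 * s * (Real.cos p.1.2 - Real.cos p.2)) ^ 2) / 2))) := by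
  have heq : (fun p : (ℝ × ℝ) × ℝ => (1 - (if (-2 * (Real.cos p.1.2 + Real.cos p.2) - p.1.1) ^ 2 + (2 * Real.sqrt 2 * s * (Real.cos p.1.2 - Real.cos p.2)) ^ 2 = 0 then (0:ℝ) else (-2 * (Real.cos p.1.2 + Real.cos p.2) - p.1.1) / Real.sqrt ((-2 * (Real.cos p.1.2 + Real.cos p.2) - p.1.1) ^ 2 + (2 * Real.sqrt 2 * s * (Real.cos p.1.2 - Real.cos p.2)) ^ 2) * Real.tanh (β * Real.sqrt ((-2 * (Real.cos p.1.2 + Real.cos p.2) - p.1.1) ^ 2 + (2 * Real.sqrt 2 * s * (Real.cos p.1.2 - Real.cos p.2)) ^ 2) / 2)))) = fun p : (ℝ × ℝ) × ℝ =>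
      1 - (-2 * (Real.cos p.1.2 + Real.cos p.2) - p.1.1) * (β / 2) * ∫ t in (0 : ℝ)..1, 1 / Real.cosh (t * (β * Real.sqrt ((-2 * (Real.cos p.1.2 + Real.cos p.2) - p.1.1) ^ 2 + (2 * Real.sqrt 2 * s * (Real.cos p.1.2 - Real.cos p.2)) ^ 2) / 2)) ^ 2 := by
    funext p
    rw [cfl_bdgPhi_eq_kernel hβ (sq_nonneg _)]
  rw [heq]
  have hT := cfl_continuous_tanhKernel
  have h1 : Continuous fun p : (ℝ × ℝ) × ℝ => (-2 * (Real.cos p.1.2 + Real.cos p.2) - p.1.1) := by fun_prop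
  have h2 : Continuous fun p : (ℝ × ℝ) × ℝ => β * Real.sqrt ((-2 * (Real.cos p.1.2 + Real.cos p.2) - p.1.1) ^ 2 + (2 * Real.sqrt 2 * s * (Real.cos p.1.2 - Real.cos p.2)) ^ 2) / 2 := by fun_prop
  exact continuous_const.sub ((h1.mul continuous_const).mul (hT.comp h2))

/-- `μ ↦ N(β,μ,s)`, the zone-averaged BdG density, is continuous (`β > 0`). [folklore] -/
theorem cdf_continuous_zoneDensity (β s : ℝ) (hβ : 0 < β) :
    Continuous fun μ : ℝ => (∫ θ₁ in (0 : ℝ)..2 * π, ∫ θ₂ in (0 : ℝ)..2 * π, (1 - (if (-2 * (Real.cos θ₁ + Real.cos θ₂) - μ) ^ 2 + (2 * Real.sqrt 2 * s * (Real.cos θ₁ - Real.cos θ₂)) ^ 2 = 0 then (0:ℝ) else (-2 * (Real.cos θ₁ + Real.cos θ₂) - μ) / Real.sqrt ((-2 * (Real.cos θ₁ + Real.cos θ₂) - μ) ^ 2 + (2 * Real.sqrt 2 * s * (Real.cos θ₁ - Real.cos θ₂)) ^ 2) * Real.tanh (β * Real.sqrt ((-2 * (Real.cos θ₁ + Real.cos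 θ₂) - μ) ^ 2 + (2 * Real.sqrt 2 * s * (Real.cos θ₁ - Real.cos θ₂)) ^ 2) / 2)))) / (4 * π ^ 2) :=
  cdf_continuous_zoneAverage (n := fun μ θ₁ θ₂ : ℝ => (1 - (if (-2 * (Real.cos θ₁ + Real.cos θ₂) - μ) ^ 2 + (2 * Real.sqrt 2 * s * (Real.cos θ₁ - Real.cos θ₂)) ^ 2 = 0 then (0:ℝ) else (-2 * (Real.cos θ₁ + Real.cos θ₂) - μ) / Real.sqrt ((-2 * (Real.cos θ₁ + Real.cos θ₂) - μ) ^ 2 + (2 * Real.sqrt 2 * s * (Real.cos θ₁ - Real.cos θ₂)) ^ 2) * Real.tanh (β * Real.sqrt ((-2 * (Real.cos θ₁ + Real.cos θ₂) - μ) ^ 2 + (2 * Real.sqrt 2 * s * (Real.cos θ₁ - Real.cos θ₂)) ^ 2) / 2)))) (cdf_continuous_bdgDensity₃ β s hβ)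

/-! ### The limit increment bracket for all real `μ` -/

/-- **Limit increment bracket, all real `μ`**: if `p_L(β,μ,s) → q₀(μ)` for every real `μ`, then for `μ₂ ≤ μ₁`
`(μ₁−μ₂)·N(β,μ₂,s) ≤ q₀(μ₁) − q₀(μ₂) ≤ (μ₁−μ₂)·N(β,μ₁,s)` with `N` the Brillouin-zone average of the BdG
density (the proof of `cfl_q0_increment_bracket`, without the interval restriction). [folklore] -/
theorem cdf_q0_increment_bracket (β s : ℝ) (hβ : 0 < β) (q₀ : ℝ → ℝ)
    (hq : ∀ μ : ℝ, ∀ κ : ℝ, 0 < κ → ∃ L₀ : ℕ, ∀ (L : ℕ) [NeZero L], L₀ ≤ L →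
      |Real.log (Matrix.partitionFn β (dWaveSourceTorus L 0 μ s)).re / (β * (L : ℝ) ^ 2) - q₀ μ| ≤ κ)
    {μ₁ μ₂ : ℝ} (hμ : μ₂ ≤ μ₁) :
    (μ₁ - μ₂) * ((∫ θ₁ in (0 : ℝ)..2 * π, ∫ θ₂ in (0 : ℝ)..2 * π, (1 - (if (-2 * (Real.cos θ₁ + Real.cos θ₂) - μ₂) ^ 2 + (2 * Real.sqrt 2 * s * (Real.cos θ₁ - Real.cos θ₂)) ^ 2 = 0 then (0:ℝ) else (-2 * (Real.cos θ₁ + Real.cos θ₂) - μ₂) / Real.sqrt ((-2 * (Real.cos θ₁ + Real.cos θ₂) - μ₂) ^ 2 + (2 * Real.sqrt 2 * s * (Real.cos θ₁ - Real.cos θ₂)) ^ 2) * Real.tanh (β * Real.sqrt ((-2 * (Real.cos θ₁ + Real.cos θ₂) - μ₂) ^ 2 + (2 * Real.sqrt 2 * s * (Real.cos θ₁ - Real.cos θ₂)) ^ 2) / 2)))) / (4 * π ^ 2)) ≤ q₀ μ₁ - q₀ μ₂ ∧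
      q₀ μ₁ - q₀ μ₂ ≤ (μ₁ - μ₂) * ((∫ θ₁ in (0 : ℝ)..2 * π, ∫ θ₂ in (0 : ℝ)..2 * π, (1 - (if (-2 * (Real.cos θ₁ + Real.cos θ₂) - μ₁) ^ 2 + (2 * Real.sqrt 2 * s * (Real.cos θ₁ - Real.cos θ₂)) ^ 2 = 0 then (0:ℝ) else (-2 * (Real.cos θ₁ + Real.cos θ₂) - μ₁) / Real.sqrt ((-2 * (Real.cos θ₁ + Real.cos θ₂) - μ₁) ^ 2 + (2 * Real.sqrt 2 * s * (Real.cos θ₁ - Real.cos θ₂)) ^ 2) * Real.tanh (β * Real.sqrt ((-2 * (Real.cos θ₁ + Real.cos θ₂) - μ₁) ^ 2 + (2 * Real.sqrt 2 * s * (Real.cos θ₁ - Real.cos θ₂)) ^ 2) / 2)))) / (4 * π ^ 2)) := by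
  have hδ : 0 ≤ μ₁ - μ₂ := sub_nonneg.2 hμ
  constructor
  · apply le_of_forall_pos_le_add
    intro η hη
    obtain ⟨L₁, hL₁⟩ := hq μ₁ (η / 4) (by positivity)
    obtain ⟨L₂, hL₂⟩ := hq μ₂ (η / 4) (by positivity)
    obtain ⟨L₃, hL₃⟩ := cfl_density_limit β μ₂ s hβ (η / (2 * (μ₁ - μ₂) + 2)) (by positivity)
    set L : ℕ := max (max L₁ L₂) (max L₃ 3) with hLdef
    have hL3 : 3 ≤ L := le_max_of_le_right (le_max_right _ _)
    haveI : NeZero L := ⟨by omega⟩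
    have a1 := hL₁ L (le_max_of_le_left (le_max_left _ _))
    have a2 := hL₂ L (le_max_of_le_left (le_max_right _ _))
    have a3 := hL₃ L (le_max_of_le_right (le_max_left _ _))
    have hfin := (cfl_pressure_increment_bracket hL3 hβ s hμ).1
    rw [abs_le] at a1 a2 a3
    rw [mul_div_assoc] at hfin
    have e1 : (μ₁ - μ₂) * ((∫ θ₁ in (0 : ℝ)..2 * π, ∫ θ₂ in (0 : ℝ)..2 * π, (1 - (if (-2 * (Real.cos θ₁ + Real.cos θ₂) - μ₂) ^ 2 + (2 * Real.sqrt 2 * s * (Real.cos θ₁ - Real.cos θ₂)) ^ 2 = 0 then (0:ℝ) else (-2 * (Real.cos θ₁ + Real.cos θ₂) - μ₂) / Real.sqrt ((-2 * (Real.cos θ₁ + Real.cos θ₂) - μ₂) ^ 2 + (2 * Real.sqrt 2 * s * (Real.cos θ₁ - Real.cos θ₂)) ^ 2) * Real.tanh (β * Real.sqrt ((-2 * (Real.cos θ₁ + Real.cos θ₂) - μ₂) ^ 2 + (2 * Real.sqrt 2 * s * (Real.cos θ₁ - Real.cos θ₂)) ^ 2) / 2)))) / (4 * π ^ 2)) 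≤
        (μ₁ - μ₂) * ((∑ k : TorusSite 2 L, (1 - (if (torusBand L k - μ₂) ^ 2 + (2 * Real.sqrt 2 * s * dWaveGap k) ^ 2 = 0 then (0:ℝ) else (torusBand L k - μ₂) / Real.sqrt ((torusBand L k - μ₂) ^ 2 + (2 * Real.sqrt 2 * s * dWaveGap k) ^ 2) * Real.tanh (β * Real.sqrt ((torusBand L k - μ₂) ^ 2 + (2 * Real.sqrt 2 * s * dWaveGap k) ^ 2) / 2)))) / (L : ℝ) ^ 2) + (μ₁ - μ₂) * (η / (2 * (μ₁ - μ₂) + 2)) := by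
      rw [← mul_add]
      exact mul_le_mul_of_nonneg_left (by linarith [a3.1]) hδ
    have e2 : (μ₁ - μ₂) * (η / (2 * (μ₁ - μ₂) + 2)) ≤ η / 2 := by
      rw [mul_div_assoc', div_le_iff₀ (by positivity)]
      nlinarith
    linarith [a1.2, a2.1]
  · apply le_of_forall_pos_le_add
    intro η hη
    obtain ⟨L₁, hL₁⟩ := hq μ₁ (η / 4) (by positivity)
    obtain ⟨L₂, hL₂⟩ := hq μ₂ (η / 4) (by positivity)
    obtain ⟨L₃, hL₃⟩ := cfl_density_limit β μ₁ s hβ (η / (2 * (μ₁ - μ₂) + 2)) (by positivity)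
    set L : ℕ := max (max L₁ L₂) (max L₃ 3) with hLdef
    have hL3 : 3 ≤ L := le_max_of_le_right (le_max_right _ _)
    haveI : NeZero L := ⟨by omega⟩
    have a1 := hL₁ L (le_max_of_le_left (le_max_left _ _))
    have a2 := hL₂ L (le_max_of_le_left (le_max_right _ _))
    have a3 := hL₃ L (le_max_of_le_right (le_max_left _ _))
    have hfin := (cfl_pressure_increment_bracket hL3 hβ s hμ).2
    rw [abs_le] at a1 a2 a3
    rw [mul_div_assoc] at hfin
    have e1 : (μ₁ - μ₂) * ((∑ k : TorusSite 2 L, (1 - (if (torusBand L k - μ₁) ^ 2 + (2 * Real.sqrt 2 * s * dWaveGap k) ^ 2 = 0 then (0:ℝ) else (torusBand L k - μ₁) / Real.sqrt ((torusBand L k - μ₁) ^ 2 + (2 * Real.sqrt 2 * s * dWaveGap k) ^ 2) * Real.tanh (β * Real.sqrt ((torusBand L k - μ₁) ^ 2 + (2 * Real.sqrt 2 * s * dWaveGap k) ^ 2) / 2)))) / (L : ℝ) ^ 2) ≤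
        (μ₁ - μ₂) * ((∫ θ₁ in (0 : ℝ)..2 * π, ∫ θ₂ in (0 : ℝ)..2 * π, (1 - (if (-2 * (Real.cos θ₁ + Real.cos θ₂) - μ₁) ^ 2 + (2 * Real.sqrt 2 * s * (Real.cos θ₁ - Real.cos θ₂)) ^ 2 = 0 then (0:ℝ) else (-2 * (Real.cos θ₁ + Real.cos θ₂) - μ₁) / Real.sqrt ((-2 * (Real.cos θ₁ + Real.cos θ₂) - μ₁) ^ 2 + (2 * Real.sqrt 2 * s * (Real.cos θ₁ - Real.cos θ₂)) ^ 2) * Real.tanh (β * Real.sqrt ((-2 * (Real.cos θ₁ + Real.cos θ₂) - μ₁) ^ 2 + (2 * Real.sqrt 2 * s * (Real.cos θ₁ - Real.cos θ₂)) ^ 2) / 2)))) / (4 * π ^ 2)) + (μ₁ - μ₂) * (η / (2 * (μ₁ - μ₂) + 2)) := by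
      rw [← mul_add]
      exact mul_le_mul_of_nonneg_left (by linarith [a3.2]) hδ
    have e2 : (μ₁ - μ₂) * (η / (2 * (μ₁ - μ₂) + 2)) ≤ η / 2 := by
      rw [mul_div_assoc', div_le_iff₀ (by positivity)]
      nlinarith
    linarith [a1.1, a2.2]

/-! ### The calibration theorem -/

/-- **Calibration `cal_freeColdDiff` (free DIFF).** For every `β > 0`, `h`, `μ`, the free (`U = 0`)
`d`-wave-sourced limit pressure `μ' ↦ I(β,μ',h) = (1/4π²)∫∫ [2log2/β − ξ + (1/β)log((1+cosh βE)/2)]` has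
derivative at `μ` equal to the zone-averaged BdG density `N(β,μ,h) = (1/4π²)∫∫ [1 − (ξ/E)tanh(βE/2)]`
(density `= ∂p/∂μ`; at `μ = 0` the value is `1`, half filling). [folklore: BdG mean-field thermodynamics] -/
theorem cal_freeColdDiff : ∀ (β μ h : ℝ), 0 < β → HasDerivAt (fun μ' : ℝ => ((∫ θ₁ in (0 : ℝ)..2 * π, ∫ θ₂ in (0 : ℝ)..2 * π, (2 * Real.log 2 / β - (-2 * (Real.cos θ₁ + Real.cos θ₂) - μ') + 1 / β * Real.log ((1 + Real.cosh (β * Real.sqrt ((-2 * (Real.cos θ₁ + Real.cos θ₂) - μ') ^ 2 + (2 * Real.sqrt 2 * h * (Real.cos θ₁ - Real.cos θ₂)) ^ 2))) / 2))) / (4 * π ^ 2))) ((∫ θ₁ in (0 : ℝ)..2 * π, ∫ θ₂ in (0 : ℝ)..2 * π, (1 - (if (-2 * (Real.cos θ₁ + Real.cos θ₂) - μ) ^ 2 + (2 * Real.sqrt 2 * h * (Real.cos θ₁ - Real.cos θ₂)) ^ 2 = 0 then (0:ℝ) else (-2 * (Real.cos θ₁ + Real.cos θ₂) - μ) / Real.sqrt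 ((-2 * (Real.cos θ₁ + Real.cos θ₂) - μ) ^ 2 + (2 * Real.sqrt 2 * h * (Real.cos θ₁ - Real.cos θ₂)) ^ 2) * Real.tanh (β * Real.sqrt ((-2 * (Real.cos θ₁ + Real.cos θ₂) - μ) ^ 2 + (2 * Real.sqrt 2 * h * (Real.cos θ₁ - Real.cos θ₂)) ^ 2) / 2)))) / (4 * π ^ 2)) μ := by
  intro β μ h hβ
  refine cdf_hasDerivAt_of_bracket
    (N := fun μ' : ℝ => (∫ θ₁ in (0 : ℝ)..2 * π, ∫ θ₂ in (0 : ℝ)..2 * π, (1 - (if (-2 * (Real.cos θ₁ + Real.cos θ₂) - μ') ^ 2 + (2 * Real.sqrt 2 * h * (Real.cos θ₁ - Real.cos θ₂)) ^ 2 = 0 then (0:ℝ) else (-2 * (Real.cos θ₁ + Real.cos θ₂) - μ') / Real.sqrt ((-2 * (Real.cos θ₁ + Real.cos θ₂) - μ') ^ 2 + (2 * Real.sqrt 2 * h * (Real.cos θ₁ - Real.cos θ₂)) ^ 2) * Real.tanh (β * Real.sqrt ((-2 * (Real.cos θ₁ + Real.cos θ₂) - μ') ^ 2 + (2 * Real.sqrt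 2 * h * (Real.cos θ₁ - Real.cos θ₂)) ^ 2) / 2)))) / (4 * π ^ 2))
    (cdf_continuous_zoneDensity β h hβ).continuousAt ?_
  intro μ₁ μ₂ hμ
  exact cdf_q0_increment_bracket β h hβ
    (fun μ' : ℝ => (∫ θ₁ in (0 : ℝ)..2 * π, ∫ θ₂ in (0 : ℝ)..2 * π, (2 * Real.log 2 / β - (-2 * (Real.cos θ₁ + Real.cos θ₂) - μ') + 1 / β * Real.log ((1 + Real.cosh (β * Real.sqrt ((-2 * (Real.cos θ₁ + Real.cos θ₂) - μ') ^ 2 + (2 * Real.sqrt 2 * h * (Real.cos θ₁ - Real.cos θ₂)) ^ 2))) / 2))) / (4 * π ^ 2))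
    (fun μ' => cfl_freeSourcedPressure_limit β μ' h hβ) hμ

end Summit.HubbardSuperconductivity.HubbardSuperconductivity.Theorems.TwSeededEnsembleEquivalenceR.ColdFloorLine
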